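import Summits.QuantumFields.YangMills.Theorems.BalabanUVNodesN15KingModelAnalyticDeterminantVolumeLawDecoupling
import Summits.QuantumFields.YangMills.Theorems.BalabanUVNodesN15KingModelAnalyticDeterminantGreenDiagonalFour
import HarnessLib

/-!
# BalabanUVNodes ∕ N15 — THE KING-MODEL RUNG (PART Ϯ-n): DECOUPLING IN KERNEL FORM — the connected second difference of `ln det(−cΔ_U + m²)` across two disjoint bond sets is bounded by
# `16c²|n|⁴·β²·#Z₁·#Z₂` with `β` ANY bound on King's `A = 0` kernel `G(x,y) = (lapF)⁻¹(x,y)` between the two supports (Kato at contraction fields, Ϛ-d at `ε = 0`); hence BOTH the decaying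
# form of PART Ϯ-l (`β = (2∕m²)C_per e^{−κ_F D∕(d+1)}`) AND an η-UNIFORM form in `d+1 = 4` at King's scaling (`β = G(0,0)`, `L²G(0,0) ≤ 5∕4 + 1∕m²`: `≤ 16|n|⁴(5∕4 + 1∕m²)²·#Z₁·#Z₂` for every `L`,
# every volume) — the two honest faces of the cluster property in the model: decay with the tree's constants, uniformity with the coincident-point bound
# (Track A, DAG node N15 = NE2; FAN-OUT v1.1 §N15 s3 «KING-MODEL RUNG … + what the curved case adds»; count-neutral)

HONEST FRAMING.  Count-neutral (cell `pub-ymgap`, seat `pub-ymgap-dag-n15-e` g54; `--supports stmt-QuantumFields-27247 --as helper` = K3ᴬ, KEY MAP v3).  As PART Ϯ-l: the FINE covariant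
normalisation on one finite torus, `𝕜 = ℝ`, `c ≥ 0`, `m² > 0`, nonempty fibre, real-orthogonal `U₀, U₁, U₂` with `U_i = U₀` off `Z_i`, `Z₁ ∩ Z₂ = ∅`.  The kernel form is the sharp statement
the tree can give today; an η-uniform AND decaying `β` (the true `c·G(x,y) ≲ e^{−m·dist}`) is door (t3⁶⁰) of the seat's HANDOFF §g54.  NOT the block-field normalisation; NOT Bałaban's (3.42);
NOT a node discharge; nothing continuum ∕ ℝ⁴ ∕ OS ∕ Clay.

CONTENT.  §1 ★ `norm_covLapF_inv_entry_le_lapF_inv_of_norm_le` (KATO AT CONTRACTION FIELDS: `‖(M_W⁻¹)_{(x,i),(y,j)}‖ ≤ G(x,y)`, Ϛ-d `norm_cxLapF_inv_entry_le` at `ε = 0`); §2 ★★★★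
**`abs_log_det_covLapF_decoupling_of_kernel_le`** (`G(x,y) ≤ β` for `x` an endpoint of `Z₁`, `y` of `Z₂` ⟹ `|Δ₁₂ ln det M| ≤ 16c²|n|⁴β²#Z₁#Z₂`; PART Ϯ-l's proof with the cross bound abstracted);
§3 (`d+1 = 4`, `c = L²`) ★★★ **`abs_log_det_covLapF_decoupling_eta_uniform`** (`≤ 16|n|⁴(5∕4 + 1∕m²)²#Z₁#Z₂`, every `L, M₀ ≥ 1` — Ϯ-e's `L²G(x,x) ≤ 5∕4 + 1∕m²` and «the diagonal dominates»).

PRIOR TREE ART (by name, not restated): Ϯ-l (`posDef_covLapF_of_norm_le`, `norm_twoParam_le`, `covLapF_add_smul_add_smul`, `cxHop_sub_apply_ne_zero`, `sum_norm_cxHop_sub_le`), Ϯ-k (`abs_re_trace_mul4_le`,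
`abs_sub_le_of_hasDerivAt_abs_le`), Ϯ-g `hasDerivAt_trace_inv_affine_mul`, Ϭ-l `hasDerivAt_log_det_affine`, Ϛ-a `cxLapF_adjoint`, Ϛ-d `norm_cxLapF_inv_entry_le`, Ε-e `abs_lapF_inv_le_diag`∕
`lapF_inv_diag_eq`, Ϯ-e `king_green_diag_eta_uniform'`, Ϟ `TorusSpectral.lapF_inv_comm` (`…BoxOperator`).  Dedup (rg at filing): basename 0 files;
`norm_covLapF_inv_entry_le_lapF_inv_of_norm_le|abs_log_det_covLapF_decoupling_of_kernel_le|abs_log_det_covLapF_decoupling_eta_uniform` 0 tree files.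
Locators: [King1986] (2.13) p.653, (3.94)–(3.96) p.669, (4.4) p.670, (4.35) p.674; [Balaban1985BackgroundPropagators] (3.23) p.394, (3.42) p.397, Thm 3.4 p.400; [Klingen1990] Ch. V §11 (15) p.141.  0 `sorry`, 0 `def`.
-/

noncomputable section

open scoped BigOperators ComplexConjugate ComplexOrder Matrix.Norms.L2Operator
open Finset Matrix Set

namespace Summit.QuantumFields.YangMills.BalabanUVNodes.N15KingModelRung.Analytic

open Literature.MathematicalPhysics.QuantumFieldTheory.Balaban1983to89.B5Prop11Plancherel (Tor fine unitVec)
open Literature.MathematicalPhysics.QuantumFieldTheory.King1986.Torus (lapF tdistT)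
open Literature.MathematicalPhysics.QuantumFieldTheory.Balaban1983to89.Beta.WoodburyFibre (cM)
open Summit.QuantumFields.YangMills.BalabanUVNodes.N15KingModelRung.Covariant
  (covLapF cxHop cxLapF_adjoint norm_cxLapF_inv_entry_le lapF_inv_entry_nonneg)
open Summit.QuantumFields.YangMills.BalabanUVNodes.N15KingModelRung.TorusSpectral (abs_lapF_inv_le_diag lapF_inv_diag_eq lapF_inv_comm)

variable {d : ℕ} (K : Fin (d + 1) → ℕ) [hK : ∀ μ, NeZero (K μ)]

/-! ## §1 Kato at contraction fields -/

section Kato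

variable {𝕜 : Type*} [RCLike 𝕜] {n : Type*} [Fintype n] [DecidableEq n]
variable {c m2 : ℝ} (hc : 0 ≤ c) (hm : 0 < m2)
include hc hm

/-- ★ KATO AT A CONTRACTION FIELD: `‖(M_W⁻¹)_{(x,i),(y,j)}‖ ≤ G(x,y) = (lapF)⁻¹(x,y)` whenever `‖W(b)‖ ≤ 1` for all `b` (Ϛ-d's two-sided domination at `ε = 0`, `V = Wᴴ`, through Ϛ-a `cxLapF_adjoint`).
[cite: Balaban1985BackgroundPropagators, Thm 3.4 p.400, (3.42) p.397; King1986, (4.4) p.670] -/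
theorem norm_covLapF_inv_entry_le_lapF_inv_of_norm_le {W : Tor K × Fin (d + 1) → Matrix n n 𝕜} (hW : ∀ b, ‖W b‖ ≤ 1 + 0) (x y : Tor K) (i j : n) :
    ‖(covLapF K c m2 W)⁻¹ (x, i) (y, j)‖ ≤ (lapF K c m2)⁻¹ x y := by
  have hW' : ∀ b, ‖(W b)ᴴ‖ ≤ 1 + 0 := fun b => by rw [Matrix.l2_opNorm_conjTranspose]; exact hW b
  have h := norm_cxLapF_inv_entry_le K hc hm le_rfl (by rw [mul_zero]; exact hm) hW hW' x y i j
  simp only [mul_zero, sub_zero, add_zero, one_mul] at h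
  rwa [cxLapF_adjoint] at h

end Kato

/-! ## §2 Decoupling with an abstract kernel bound -/

section Kernel

variable {n : Type*} [Fintype n] [DecidableEq n] [Nonempty n]
variable {c m2 : ℝ} (hc : 0 ≤ c) (hm : 0 < m2)
variable {U₀ U₁ U₂ : Tor K × Fin (d + 1) → Matrix n n ℝ} (hU₀ : ∀ b, U₀ b ∈ Matrix.unitaryGroup n ℝ) (hU₁ : ∀ b, U₁ b ∈ Matrix.unitaryGroup n ℝ)
  (hU₂ : ∀ b, U₂ b ∈ Matrix.unitaryGroup n ℝ)
variable {Z₁ Z₂ : Finset (Tor K × Fin (d + 1))} (h₁ : ∀ b, b ∉ Z₁ → U₁ b = U₀ b) (h₂ : ∀ b, b ∉ Z₂ → U₂ b = U₀ b) (hZ : Disjoint Z₁ Z₂)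
variable {β : ℝ} (hker : ∀ x y : Tor K, (∃ b ∈ Z₁, x = b.1 ∨ x = b.1 + unitVec K b.2) → (∃ b ∈ Z₂, y = b.1 ∨ y = b.1 + unitVec K b.2) → (lapF K c m2)⁻¹ x y ≤ β)
include hc hm hU₀ hU₁ hU₂ h₁ h₂ hZ hker

/-- ★★★★ **DECOUPLING IN KERNEL FORM**: if King's `A = 0` kernel between the endpoints of `Z₁` and of `Z₂` is `≤ β`, then
`|ln det M(U₁+U₂−U₀) − ln det M(U₁) − ln det M(U₂) + ln det M(U₀)| ≤ 16c²|n|⁴·β²·#Z₁·#Z₂` — PART Ϯ-l's argument with the cross bound abstracted: Kato at the contraction fields of the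
two-parameter interpolation puts every relevant entry of the interpolated covariance below `G(x,y) ≤ β`. [cite: King1986, (2.13) p.653, (3.94)–(3.96) p.669, (4.4) p.670;
Balaban1985BackgroundPropagators, (3.23) p.394, (3.42) p.397, Thm 3.4 p.400; Klingen1990, Ch. V §11 (15) p.141] -/
theorem abs_log_det_covLapF_decoupling_of_kernel_le :
    |Real.log (covLapF K c m2 (U₁ + U₂ - U₀)).det - Real.log (covLapF K c m2 U₁).det - Real.log (covLapF K c m2 U₂).det + Real.log (covLapF K c m2 U₀).det|
      ≤ 16 * c ^ 2 * (Fintype.card n : ℝ) ^ 4 * β ^ 2 * Z₁.card * Z₂.card := by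
  -- degenerate case: if `Z₁` or `Z₂` is empty the left-hand side vanishes; otherwise `β ≥ 0` from the kernel's nonnegativity
  by_cases hβ0 : 0 ≤ β
  swap
  · -- `β < 0` forces one of the supports to be empty (the kernel is `≥ 0`)
    have hempty : Z₁ = ∅ ∨ Z₂ = ∅ := by
      by_contra hne
      push Not at hne
      obtain ⟨b₁, hb₁⟩ := hne.1
      obtain ⟨b₂, hb₂⟩ := hne.2
      have h := hker b₁.1 b₂.1 ⟨b₁, hb₁, Or.inl rfl⟩ ⟨b₂, hb₂, Or.inl rfl⟩
      exact hβ0 ((lapF_inv_entry_nonneg K hc hm _ _).trans h)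
    rcases hempty with h0 | h0
    · have e1 : U₁ = U₀ := funext fun b => h₁ b (by rw [h0]; exact Finset.notMem_empty b)
      have e12 : U₁ + U₂ - U₀ = U₂ := by rw [e1]; abel
      rw [e12, e1, h0, Finset.card_empty]; simp
    · have e2 : U₂ = U₀ := funext fun b => h₂ b (by rw [h0]; exact Finset.notMem_empty b)
      have e12 : U₁ + U₂ - U₀ = U₁ := by rw [e2]; abel
      rw [e12, e2, h0, Finset.card_empty]; simp
  -- the data (as in PART Ϯ-l)
  set M₀ := covLapF K c m2 U₀ with hM₀
  set E₁ := -cxHop K c (U₁ - U₀) (fun b => ((U₁ - U₀) b)ᴴ) with hE₁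
  set E₂ := -cxHop K c (U₂ - U₀) (fun b => ((U₂ - U₀) b)ᴴ) with hE₂
  set ℓ₁ : ℝ := ∑ p : Tor K × n, ∑ q : Tor K × n, ‖E₁ p q‖ with hℓ₁
  set ℓ₂ : ℝ := ∑ p : Tor K × n, ∑ q : Tor K × n, ‖E₂ p q‖ with hℓ₂
  set B : ℝ := β * β * ℓ₁ * ℓ₂ with hB
  have haff : ∀ s t : ℝ, covLapF K c m2 (U₀ + s • (U₁ - U₀) + t • (U₂ - U₀)) = M₀ + s • E₁ + t • E₂ := by
    intro s t
    rw [covLapF_add_smul_add_smul, hM₀, hE₁, hE₂, smul_neg, smul_neg]; abel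
  have hcontr : ∀ {s t : ℝ}, s ∈ Icc (0 : ℝ) 1 → t ∈ Icc (0 : ℝ) 1 → ∀ b, ‖(U₀ + s • (U₁ - U₀) + t • (U₂ - U₀)) b‖ ≤ 1 + 0 :=
    fun hs ht b => norm_twoParam_le K hU₀ hU₁ hU₂ h₁ h₂ hZ hs ht b
  have hpd : ∀ {s t : ℝ}, s ∈ Icc (0 : ℝ) 1 → t ∈ Icc (0 : ℝ) 1 → (M₀ + s • E₁ + t • E₂).PosDef := fun hs ht => by
    rw [← haff]; exact posDef_covLapF_of_norm_le K hc hm (hcontr hs ht)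
  have hdet : ∀ {s t : ℝ}, s ∈ Icc (0 : ℝ) 1 → t ∈ Icc (0 : ℝ) 1 → (M₀ + s • E₁ + t • E₂).det ≠ 0 := fun hs ht => (hpd hs ht).det_pos.ne'
  -- cross entries of the interpolated covariance are below `β` (Kato at contraction fields)
  have hcross : ∀ {s t : ℝ}, s ∈ Icc (0 : ℝ) 1 → t ∈ Icc (0 : ℝ) 1 → ∀ α γ : Tor K × n,
      ((∃ b ∈ Z₁, α.1 = b.1 ∨ α.1 = b.1 + unitVec K b.2) ∧ (∃ b ∈ Z₂, γ.1 = b.1 ∨ γ.1 = b.1 + unitVec K b.2)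
        ∨ (∃ b ∈ Z₂, α.1 = b.1 ∨ α.1 = b.1 + unitVec K b.2) ∧ (∃ b ∈ Z₁, γ.1 = b.1 ∨ γ.1 = b.1 + unitVec K b.2)) →
      ‖(M₀ + s • E₁ + t • E₂)⁻¹ α γ‖ ≤ β := by
    intro s t hs ht α γ hαγ
    obtain ⟨x, i⟩ := α
    obtain ⟨y, j⟩ := γ
    have h := norm_covLapF_inv_entry_le_lapF_inv_of_norm_le K hc hm (hcontr hs ht) x y i j
    rw [haff] at h
    refine h.trans ?_
    rcases hαγ with ⟨hx, hy⟩ | ⟨hx, hy⟩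
    · exact hker x y hx hy
    · rw [lapF_inv_comm]; exact hker y x hy hx
  have hsuppE₁ : ∀ β' γ : Tor K × n, E₁ β' γ ≠ 0 → (∃ b ∈ Z₁, β'.1 = b.1 ∨ β'.1 = b.1 + unitVec K b.2) ∧ (∃ b ∈ Z₁, γ.1 = b.1 ∨ γ.1 = b.1 + unitVec K b.2) :=
    fun β' γ hne => cxHop_sub_apply_ne_zero K h₁ c (by rwa [hE₁, Matrix.neg_apply, neg_ne_zero] at hne)
  have hsuppE₂ : ∀ δ α : Tor K × n, E₂ δ α ≠ 0 → (∃ b ∈ Z₂, δ.1 = b.1 ∨ δ.1 = b.1 + unitVec K b.2) ∧ (∃ b ∈ Z₂, α.1 = b.1 ∨ α.1 = b.1 + unitVec K b.2) :=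
    fun δ α hne => cxHop_sub_apply_ne_zero K h₂ c (by rwa [hE₂, Matrix.neg_apply, neg_ne_zero] at hne)
  have hmixed : ∀ {s t : ℝ}, s ∈ Icc (0 : ℝ) 1 → t ∈ Icc (0 : ℝ) 1 →
      |((M₀ + s • E₁ + t • E₂)⁻¹ * E₁ * (M₀ + s • E₁ + t • E₂)⁻¹ * E₂).trace| ≤ B := by
    intro s t hs ht
    have h := abs_re_trace_mul4_le (𝕜 := ℝ) (P := (M₀ + s • E₁ + t • E₂)⁻¹) (Q := (M₀ + s • E₁ + t • E₂)⁻¹) (E₁ := E₁) (E₂ := E₂)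
      (T₁ := fun p : Tor K × n => ∃ b ∈ Z₁, p.1 = b.1 ∨ p.1 = b.1 + unitVec K b.2) (T₂ := fun p : Tor K × n => ∃ b ∈ Z₂, p.1 = b.1 ∨ p.1 = b.1 + unitVec K b.2)
      hβ0 hsuppE₁ hsuppE₂ (fun α β' hα hβ' => hcross hs ht α β' (Or.inr ⟨hα, hβ'⟩)) (fun γ δ hγ hδ => hcross hs ht γ δ (Or.inl ⟨hγ, hδ⟩))
    simp only [RCLike.re_to_real] at h
    rw [hB]; linarith [h]
  have hG : ∀ {t : ℝ}, t ∈ Icc (0 : ℝ) 1 → |((M₀ + t • E₂ + (1 : ℝ) • E₁)⁻¹ * E₂).trace - ((M₀ + t • E₂ + (0 : ℝ) • E₁)⁻¹ * E₂).trace| ≤ B := by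
    intro t ht
    refine abs_sub_le_of_hasDerivAt_abs_le (ψ := fun s => ((M₀ + t • E₂ + s • E₁)⁻¹ * E₂).trace)
      (ψ' := fun s => -((M₀ + t • E₂ + s • E₁)⁻¹ * E₁ * (M₀ + t • E₂ + s • E₁)⁻¹ * E₂).trace) (fun s hs => ?_) (fun s hs => ?_)
    · have hd : (M₀ + t • E₂ + s • E₁).det ≠ 0 := by rw [add_right_comm]; exact hdet hs ht
      exact hasDerivAt_trace_inv_affine_mul (M₀ + t • E₂) E₁ E₂ hd
    · rw [abs_neg, add_right_comm]
      exact hmixed hs ht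
  have hF := abs_sub_le_of_hasDerivAt_abs_le (B := B) (ψ := fun t => Real.log (M₀ + E₁ + t • E₂).det - Real.log (M₀ + t • E₂).det)
    (ψ' := fun t => ((M₀ + E₁ + t • E₂)⁻¹ * E₂).trace - ((M₀ + t • E₂)⁻¹ * E₂).trace)
    (fun t ht => by
      have hd1 : (M₀ + E₁ + t • E₂).det ≠ 0 := by
        have := hdet (right_mem_Icc.mpr zero_le_one) ht; rwa [one_smul] at this
      have hd0 : (M₀ + t • E₂).det ≠ 0 := by
        have := hdet (left_mem_Icc.mpr zero_le_one) ht; rwa [zero_smul, add_zero] at this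
      exact (hasDerivAt_log_det_affine (M₀ + E₁) E₂ hd1).sub (hasDerivAt_log_det_affine M₀ E₂ hd0))
    (fun t ht => by
      have h := hG ht
      rw [one_smul, zero_smul, add_zero, add_right_comm] at h
      exact h)
  have hW11 : U₀ + (1 : ℝ) • (U₁ - U₀) + (1 : ℝ) • (U₂ - U₀) = U₁ + U₂ - U₀ := by rw [one_smul, one_smul]; abel
  have hW10 : U₀ + (1 : ℝ) • (U₁ - U₀) + (0 : ℝ) • (U₂ - U₀) = U₁ := by rw [one_smul, zero_smul, add_zero]; abel
  have hW01 : U₀ + (0 : ℝ) • (U₁ - U₀) + (1 : ℝ) • (U₂ - U₀) = U₂ := by rw [one_smul, zero_smul, add_zero]; abel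
  have e12 : M₀ + E₁ + (1 : ℝ) • E₂ = covLapF K c m2 (U₁ + U₂ - U₀) := by
    have h := haff 1 1; rw [hW11] at h; rw [h, one_smul, one_smul]
  have e1 : M₀ + E₁ + (0 : ℝ) • E₂ = covLapF K c m2 U₁ := by
    have h := haff 1 0; rw [hW10] at h; rw [h, one_smul, zero_smul, add_zero]
  have e2 : M₀ + (1 : ℝ) • E₂ = covLapF K c m2 U₂ := by
    have h := haff 0 1; rw [hW01] at h; rw [h, one_smul, zero_smul, add_zero]
  have e0 : M₀ + (0 : ℝ) • E₂ = covLapF K c m2 U₀ := by rw [zero_smul, add_zero]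
  simp only [e12, e1, e2, e0] at hF
  have hℓ₁ : ℓ₁ ≤ 4 * c * (Fintype.card n : ℝ) ^ 2 * Z₁.card := by
    have h := sum_norm_cxHop_sub_le K hU₀ hU₁ h₁ hc
    rw [hℓ₁, hE₁]; simpa only [Matrix.neg_apply, norm_neg] using h
  have hℓ₂ : ℓ₂ ≤ 4 * c * (Fintype.card n : ℝ) ^ 2 * Z₂.card := by
    have h := sum_norm_cxHop_sub_le K hU₀ hU₂ h₂ hc
    rw [hℓ₂, hE₂]; simpa only [Matrix.neg_apply, norm_neg] using h
  have hℓ₂0 : 0 ≤ ℓ₂ := Finset.sum_nonneg fun _ _ => Finset.sum_nonneg fun _ _ => norm_nonneg _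
  have hBle : B ≤ 16 * c ^ 2 * (Fintype.card n : ℝ) ^ 4 * β ^ 2 * Z₁.card * Z₂.card := by
    rw [hB]
    calc β * β * ℓ₁ * ℓ₂ ≤ β * β * (4 * c * (Fintype.card n : ℝ) ^ 2 * Z₁.card) * (4 * c * (Fintype.card n : ℝ) ^ 2 * Z₂.card) :=
          mul_le_mul (mul_le_mul_of_nonneg_left hℓ₁ (mul_nonneg hβ0 hβ0)) hℓ₂ hℓ₂0 (by positivity)
      _ = 16 * c ^ 2 * (Fintype.card n : ℝ) ^ 4 * β ^ 2 * Z₁.card * Z₂.card := by ring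
  have efin : Real.log (covLapF K c m2 (U₁ + U₂ - U₀)).det - Real.log (covLapF K c m2 U₁).det - Real.log (covLapF K c m2 U₂).det + Real.log (covLapF K c m2 U₀).det
      = (Real.log (covLapF K c m2 (U₁ + U₂ - U₀)).det - Real.log (covLapF K c m2 U₂).det) - (Real.log (covLapF K c m2 U₁).det - Real.log (covLapF K c m2 U₀).det) := by ring
  rw [efin]
  exact hF.trans hBle

end Kernel

/-! ## §3 The η-uniform face in four dimensions -/

section Four

variable {L : ℕ} [NeZero L] (M₀ : ℕ) [NeZero M₀]
variable {n : Type*} [Fintype n] [DecidableEq n] [Nonempty n]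
variable {m2 : ℝ} (hm : 0 < m2)
variable {U₀ U₁ U₂ : Tor (fine L (cM M₀)) × Fin (3 + 1) → Matrix n n ℝ} (hU₀ : ∀ b, U₀ b ∈ Matrix.unitaryGroup n ℝ) (hU₁ : ∀ b, U₁ b ∈ Matrix.unitaryGroup n ℝ)
  (hU₂ : ∀ b, U₂ b ∈ Matrix.unitaryGroup n ℝ)
variable {Z₁ Z₂ : Finset (Tor (fine L (cM M₀)) × Fin (3 + 1))} (h₁ : ∀ b, b ∉ Z₁ → U₁ b = U₀ b) (h₂ : ∀ b, b ∉ Z₂ → U₂ b = U₀ b) (hZ : Disjoint Z₁ Z₂)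
include hm hU₀ hU₁ hU₂ h₁ h₂ hZ

/-- ★★★ **THE η-UNIFORM FACE OF THE DECOUPLING** (`d+1 = 4`, King's scaling `c = L²`, fine torus `(ℤ∕LM₀)⁴`, NO separation hypothesis): the interaction of two changes on disjoint bond sets is
`|ln det M(U₁+U₂−U₀) − ln det M(U₁) − ln det M(U₂) + ln det M(U₀)| ≤ 16|n|⁴(5∕4 + 1∕m²)²·#Z₁·#Z₂` for EVERY `L ≥ 1` and EVERY volume — the kernel form with `β = G(0,0)` (the diagonal dominates,
Ε-e) and Ϯ-e's coincident-point bound `L²G(0,0) ≤ 5∕4 + 1∕m²` (transience of the 4-d walk). [cite: King1986, (2.13) p.653, (4.4) p.670, (4.35) p.674; Balaban1985BackgroundPropagators, (3.42) p.397] -/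
theorem abs_log_det_covLapF_decoupling_eta_uniform :
    |Real.log (covLapF (fine L (cM M₀)) ((L : ℝ) ^ 2) m2 (U₁ + U₂ - U₀)).det - Real.log (covLapF (fine L (cM M₀)) ((L : ℝ) ^ 2) m2 U₁).det
        - Real.log (covLapF (fine L (cM M₀)) ((L : ℝ) ^ 2) m2 U₂).det + Real.log (covLapF (fine L (cM M₀)) ((L : ℝ) ^ 2) m2 U₀).det|
      ≤ 16 * (Fintype.card n : ℝ) ^ 4 * (5 / 4 + m2⁻¹) ^ 2 * Z₁.card * Z₂.card := by
  have hc : (0 : ℝ) ≤ (L : ℝ) ^ 2 := by positivity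
  set β : ℝ := (lapF (fine L (cM M₀)) ((L : ℝ) ^ 2) m2)⁻¹ 0 0 with hβ
  have hker : ∀ x y : Tor (fine L (cM M₀)), (∃ b ∈ Z₁, x = b.1 ∨ x = b.1 + unitVec (fine L (cM M₀)) b.2) →
      (∃ b ∈ Z₂, y = b.1 ∨ y = b.1 + unitVec (fine L (cM M₀)) b.2) → (lapF (fine L (cM M₀)) ((L : ℝ) ^ 2) m2)⁻¹ x y ≤ β := by
    intro x y _ _
    have h := (le_abs_self _).trans (abs_lapF_inv_le_diag (fine L (cM M₀)) hc hm x y)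
    rw [hβ, lapF_inv_diag_eq (fine L (cM M₀)) hc hm 0, ← lapF_inv_diag_eq (fine L (cM M₀)) hc hm x]
    exact h
  have h := abs_log_det_covLapF_decoupling_of_kernel_le (fine L (cM M₀)) hc hm hU₀ hU₁ hU₂ h₁ h₂ hZ hker
  have hg : (L : ℝ) ^ 2 * β ≤ 5 / 4 + m2⁻¹ := king_green_diag_eta_uniform' L M₀ hm 0
  have hβ0 : 0 ≤ β := lapF_inv_entry_nonneg (fine L (cM M₀)) hc hm 0 0
  refine h.trans ?_
  have e : 16 * ((L : ℝ) ^ 2) ^ 2 * (Fintype.card n : ℝ) ^ 4 * β ^ 2 * Z₁.card * Z₂.card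
      = 16 * (Fintype.card n : ℝ) ^ 4 * ((L : ℝ) ^ 2 * β) ^ 2 * Z₁.card * Z₂.card := by ring
  rw [e]
  have hn : (0 : ℝ) ≤ 16 * (Fintype.card n : ℝ) ^ 4 := by positivity
  have hsq : ((L : ℝ) ^ 2 * β) ^ 2 ≤ (5 / 4 + m2⁻¹) ^ 2 := pow_le_pow_left₀ (by positivity) hg 2
  have hZZ : (0 : ℝ) ≤ (Z₁.card : ℝ) * Z₂.card := by positivity
  calc 16 * (Fintype.card n : ℝ) ^ 4 * ((L : ℝ) ^ 2 * β) ^ 2 * Z₁.card * Z₂.card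
      = 16 * (Fintype.card n : ℝ) ^ 4 * ((L : ℝ) ^ 2 * β) ^ 2 * ((Z₁.card : ℝ) * Z₂.card) := by ring
    _ ≤ 16 * (Fintype.card n : ℝ) ^ 4 * (5 / 4 + m2⁻¹) ^ 2 * ((Z₁.card : ℝ) * Z₂.card) :=
        mul_le_mul_of_nonneg_right (mul_le_mul_of_nonneg_left hsq hn) hZZ
    _ = 16 * (Fintype.card n : ℝ) ^ 4 * (5 / 4 + m2⁻¹) ^ 2 * Z₁.card * Z₂.card := by ring

end Four

end Summit.QuantumFields.YangMills.BalabanUVNodes.N15KingModelRung.Analytic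

end
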